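import Summits.Ventures.PercRepro.C041TriangleSeedRegion

/-!
# THE LAST SEED ON TWO MORE FAMILIES — two deformed leaves with `p ≥ 2` type-1 marks (by L₁) or with `q ≥ 4` type-2
marks (by L₂(1, 0); proved for `q ≥ 11`, numerically valid from `q = 4`) (mine-3, gen 62; C-041.md §21 (av))

`InCone_thetaTri_v1_pow_one_v_v (p ≥ 2) (x y ∈ [0, 1]) : InCone (thetaTri (v 1) (v 1 ^ p * v x * v y))` and
`InCone_thetaTri_v1_v_v_pow_zero (q ≥ 11) (x y ∈ [0, 1]) : InCone (thetaTri (v 1) (v x * v y * v 0 ^ q))` — four-or-more-leaf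
two-parameter families of the seed `θ_△(v 1, V b) ∈ cone`, from the region theorems of C041TriangleSeedRegion: the seven
sign conditions are polynomial inequalities in `(x, y)` with `2 ^ p ≥ 4` (resp. `2 ^ q ≥ 2048`), closed by `linarith` /
`nlinarith` from explicit Handelman / sum-of-squares hints.
-/

namespace PercRepro

namespace RelaxedTriangle

open TreeClosure

/-- The coordinates of `v 1 ^ p * v x * v y` for `p ≥ 1`. -/
theorem pow_one_mul_v_mul_v_coords (p : ℕ) (hp : 1 ≤ p) (x y : ℝ) :
    (v 1 ^ p * v x * v y) 0 = 1 ∧ (v 1 ^ p * v x * v y) 1 = 2 ^ p * ((1 + x ^ 2) * (1 + y ^ 2))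
      ∧ (v 1 ^ p * v x * v y) 2 = (1 + (1 - x) ^ 2) * (1 + (1 - y) ^ 2)
      ∧ (v 1 ^ p * v x * v y) 3 = 0 ∧ (v 1 ^ p * v x * v y) 4 = x * y ∧ (v 1 ^ p * v x * v y) 5 = 0 := by
  have hp0 : p ≠ 0 := by omega
  refine ⟨?_, ?_, ?_, ?_, ?_, ?_⟩ <;> simp [Pi.pow_apply, v, hp0]
  norm_num; ring

/-- The coordinates of `v x * v y * v 0 ^ q` for `q ≥ 1`. -/
theorem v_mul_v_mul_pow_zero_coords (q : ℕ) (hq : 1 ≤ q) (x y : ℝ) :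
    (v x * v y * v 0 ^ q) 0 = 1 ∧ (v x * v y * v 0 ^ q) 1 = (1 + x ^ 2) * (1 + y ^ 2)
      ∧ (v x * v y * v 0 ^ q) 2 = 2 ^ q * ((1 + (1 - x) ^ 2) * (1 + (1 - y) ^ 2))
      ∧ (v x * v y * v 0 ^ q) 3 = 0 ∧ (v x * v y * v 0 ^ q) 4 = 0 ∧ (v x * v y * v 0 ^ q) 5 = (1 - x) * (1 - y) := by
  have hq0 : q ≠ 0 := by omega
  refine ⟨?_, ?_, ?_, ?_, ?_, ?_⟩ <;> simp [Pi.pow_apply, v, hq0]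
  ring

/-- **THEOREM (THE MARK AGAINST `p ≥ 2` TYPE-1 MARKS AND TWO DEFORMED LEAVES)**: `θ_△(v 1, v 1 ^ p * v x * v y) ∈ cone`
for every `p ≥ 2` and all `x, y ∈ [0, 1]`, by the certificate L₁ (the all-1 case `x = y = 1` is `thetaTri_pow_one_InCone`). -/
theorem InCone_thetaTri_v1_pow_one_v_v (p : ℕ) (hp : 2 ≤ p) (x y : ℝ) (hx : 0 ≤ x ∧ x ≤ 1) (hy : 0 ≤ y ∧ y ≤ 1) :
    InCone (thetaTri (v 1) (v 1 ^ p * v x * v y)) := by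
  by_cases h11 : x = 1 ∧ y = 1
  · obtain ⟨rfl, rfl⟩ := h11
    have e : v 1 ^ p * v 1 * v 1 = v 1 ^ (p + 2) := by rw [pow_succ, pow_succ]
    rw [e]
    have := thetaTri_pow_one_InCone 1 (p + 2)
    simpa using this
  · obtain ⟨c0, c1, c2, c3, c4, c5⟩ := pow_one_mul_v_mul_v_coords p (by omega) x y
    have hP : (4 : ℝ) ≤ 2 ^ p := by
      calc (4 : ℝ) = 2 ^ 2 := by norm_num
        _ ≤ 2 ^ p := pow_le_pow_right₀ (by norm_num) hp
    set P : ℝ := 2 ^ p with hPdef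
    have hx0 := hx.1; have hx1 := hx.2; have hy0 := hy.1; have hy1 := hy.2
    -- the substitution a = 1 - x, b = 1 - y
    obtain ⟨a, rfl⟩ : ∃ a, x = 1 - a := ⟨1 - x, by ring⟩
    obtain ⟨b, rfl⟩ : ∃ b, y = 1 - b := ⟨1 - y, by ring⟩
    have ha0 : 0 ≤ a := by linarith
    have ha1 : 0 ≤ 1 - a := by linarith
    have hb0 : 0 ≤ b := by linarith
    have hb1 : 0 ≤ 1 - b := by linarith
    simp only [sub_sub_cancel] at c2 c5 c1 c4
    -- q := (1+a²)(1+b²) > 1 (not both a = b = 0), r := (1+(1-a)²)(1+(1-b)²) ≥ 1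
    have hq : 1 < (1 + a ^ 2) * (1 + b ^ 2) := by
      rcases eq_or_lt_of_le ha0 with h1 | h1
      · subst h1
        have hb : b ≠ 0 := fun h => h11 ⟨by ring, by rw [h]; ring⟩
        have : 0 < b ^ 2 := by positivity
        nlinarith
      · have : 0 < a ^ 2 := by positivity
        nlinarith [sq_nonneg b]
    have hr : (1 : ℝ) ≤ (1 + (1 - a) ^ 2) * (1 + (1 - b) ^ 2) := by
      nlinarith [sq_nonneg (1 - a), sq_nonneg (1 - b), mul_nonneg (sq_nonneg (1 - a)) (sq_nonneg (1 - b))]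
    -- U := 4 - q - 3(1-a)(1-b) = 3a + 3b - a² - b² - 3ab - a²b²: 0 ≤ U ≤ 3(a+b)(1-ab)
    have hU : 0 ≤ 4 - (1 + a ^ 2) * (1 + b ^ 2) - 3 * ((1 - a) * (1 - b)) := by
      linarith [mul_nonneg ha0 ha1, mul_nonneg hb0 hb1, mul_nonneg ha0 hb1, mul_nonneg hb0 ha1,
        mul_nonneg (mul_nonneg ha0 hb0) (by nlinarith : (0:ℝ) ≤ 1 - a * b)]
    have hUup : 4 - (1 + a ^ 2) * (1 + b ^ 2) - 3 * ((1 - a) * (1 - b)) ≤ 3 * (a + b) * (1 - a * b) := by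
      linarith [mul_nonneg (sq_nonneg a) hb1, mul_nonneg (sq_nonneg b) ha1,
        mul_nonneg (mul_nonneg ha0 hb0) (mul_nonneg ha1 hb1), mul_nonneg (mul_nonneg ha0 hb0) ha1, mul_nonneg (mul_nonneg ha0 hb0) hb1]
    have hs : (a + b) ^ 2 ≤ 2 * ((1 + a ^ 2) * (1 + b ^ 2) - 1) := by
      linarith [sq_nonneg (a - b), sq_nonneg (a * b)]
    -- the Handelman certificate (degree 5) of m₂-bound: 12r - (q+9)/2 + (1-a)(1-b) - 18(1-ab)² ≥ 0
    have hm : 18 * (1 - a * b) ^ 2 ≤ 12 * ((1 + (1 - a) ^ 2) * (1 + (1 - b) ^ 2)) - ((1 + a ^ 2) * (1 + b ^ 2) + 9) / 2 + (1 - a) * (1 - b) := by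
      linarith [mul_nonneg (pow_nonneg ha1 1) (pow_nonneg hb1 3), mul_nonneg (pow_nonneg ha1 2) (pow_nonneg hb1 2),
        mul_nonneg (pow_nonneg ha1 3) (pow_nonneg hb1 1), mul_nonneg (mul_nonneg (pow_nonneg hb0 1) (pow_nonneg ha1 2)) (pow_nonneg hb1 2),
        mul_nonneg (pow_nonneg hb0 3) (pow_nonneg ha1 1), mul_nonneg (mul_nonneg (pow_nonneg ha0 1) (pow_nonneg ha1 2)) (pow_nonneg hb1 2),
        mul_nonneg (mul_nonneg (pow_nonneg ha0 1) (pow_nonneg hb0 2)) (pow_nonneg ha1 1), mul_nonneg (mul_nonneg (pow_nonneg ha0 1) (pow_nonneg hb0 3)) (pow_nonneg ha1 1),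
        mul_nonneg (pow_nonneg ha0 2) (pow_nonneg hb0 1), mul_nonneg (mul_nonneg (pow_nonneg ha0 2) (pow_nonneg hb0 1)) (pow_nonneg hb1 1),
        mul_nonneg (mul_nonneg (pow_nonneg ha0 2) (pow_nonneg hb0 2)) (pow_nonneg ha1 1), pow_nonneg ha0 3,
        mul_nonneg (mul_nonneg (pow_nonneg ha0 3) (pow_nonneg hb0 1)) (pow_nonneg hb1 1)]
    have hab1 : 0 ≤ 1 - a * b := by nlinarith
    -- the seven conditions of L₁
    have hD2 : 0 < 4 * ((1 + a ^ 2) * (1 + b ^ 2)) - 4 * 1 - 2 * 0 + 2 * 0 := by linarith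
    have hD12 : 4 * ((1 + a ^ 2) * (1 + b ^ 2)) - 4 * 1 - 2 * 0 + 2 * 0
        ≤ 4 * 1 + 2 * ((1 + a ^ 2) * (1 + b ^ 2)) + 4 * 0 - 6 * ((1 - a) * (1 - b)) - 4 * 0 := by linarith
    have h3 : 0 ≤ 2 * 1 + 0 + 2 * ((1 - a) * (1 - b)) + 0 := by linarith [mul_nonneg ha1 hb1]
    have hc0 : 0 ≤ (1 + a ^ 2) * (1 + b ^ 2) - 1 + 0 - 0 := by linarith
    have hlam : 0 ≤ 5 * (P * ((1 + (1 - a) ^ 2) * (1 + (1 - b) ^ 2))) - 2 * 1 + 4 * ((1 - a) * (1 - b)) + 0 - 3 * 0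
        - (((6 * (P * ((1 + (1 - a) ^ 2) * (1 + (1 - b) ^ 2))) - (1 + a ^ 2) * (1 + b ^ 2) - 9 * 1 - 0 + 2 * ((1 - a) * (1 - b)) + 3 * 0) / 2)
          + (4 * 1 + 2 * ((1 + a ^ 2) * (1 + b ^ 2)) + 4 * 0 - 6 * ((1 - a) * (1 - b)) - 4 * 0)
          - (4 * ((1 + a ^ 2) * (1 + b ^ 2)) - 4 * 1 - 2 * 0 + 2 * 0)) := by
      have t1 := mul_nonneg ha1 hb1
      have t2 := mul_nonneg (by linarith : (0:ℝ) ≤ P - 4) (by linarith : (0:ℝ) ≤ (1 + (1 - a) ^ 2) * (1 + (1 - b) ^ 2) - 1)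
      have t3 := mul_nonneg (sq_nonneg a) (sq_nonneg b)
      nlinarith [t1, t2, t3, sq_nonneg a, sq_nonneg b]
    have hH : ((4 * 1 + 2 * ((1 + a ^ 2) * (1 + b ^ 2)) + 4 * 0 - 6 * ((1 - a) * (1 - b)) - 4 * 0)
          - (4 * ((1 + a ^ 2) * (1 + b ^ 2)) - 4 * 1 - 2 * 0 + 2 * 0)) ^ 2
        ≤ ((6 * (P * ((1 + (1 - a) ^ 2) * (1 + (1 - b) ^ 2))) - (1 + a ^ 2) * (1 + b ^ 2) - 9 * 1 - 0 + 2 * ((1 - a) * (1 - b)) + 3 * 0) / 2)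
          * (4 * ((1 + a ^ 2) * (1 + b ^ 2)) - 4 * 1 - 2 * 0 + 2 * 0) := by
      clear c0 c1 c2 c3 c4 c5 hlam h3 hc0 hD12 hD2 hx hy h11
      generalize hq' : (1 + a ^ 2) * (1 + b ^ 2) = q at *
      generalize hr' : (1 + (1 - a) ^ 2) * (1 + (1 - b) ^ 2) = r at *
      generalize hw' : (1 - a) * (1 - b) = w at *
      have hq1 : 0 < q - 1 := by linarith
      have hw0 : 0 ≤ w := by rw [← hw']; exact mul_nonneg ha1 hb1
      have hm2 : 12 * r - (q + 9) / 2 + w ≤ (6 * (P * r) - q - 9 * 1 - 0 + 2 * w + 3 * 0) / 2 := by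
        nlinarith only [mul_nonneg (by linarith : (0:ℝ) ≤ P - 4) (by linarith : (0:ℝ) ≤ r)]
      have hU2 : (4 - q - 3 * w) ^ 2 ≤ (3 * (a + b) * (1 - a * b)) ^ 2 := pow_le_pow_left₀ hU hUup 2
      have hchain : (3 * (a + b) * (1 - a * b)) ^ 2 ≤ (12 * r - (q + 9) / 2 + w) * (q - 1) := by
        have e1 : (3 * (a + b) * (1 - a * b)) ^ 2 = 9 * (a + b) ^ 2 * (1 - a * b) ^ 2 := by ring
        rw [e1]
        calc 9 * (a + b) ^ 2 * (1 - a * b) ^ 2 ≤ 9 * (2 * (q - 1)) * (1 - a * b) ^ 2 := by gcongr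
          _ = (18 * (1 - a * b) ^ 2) * (q - 1) := by ring
          _ ≤ (12 * r - (q + 9) / 2 + w) * (q - 1) := by gcongr
      have e : (4 * 1 + 2 * q + 4 * 0 - 6 * w - 4 * 0 - (4 * q - 4 * 1 - 2 * 0 + 2 * 0)) ^ 2 = 4 * (4 - q - 3 * w) ^ 2 := by ring
      have e2 : 4 * q - 4 * 1 - 2 * 0 + 2 * 0 = 4 * (q - 1) := by ring
      rw [e, e2]
      have := mul_le_mul_of_nonneg_right hm2 hq1.le
      nlinarith only [hU2, hchain, this]
    exact InCone_thetaTri_v1_of_L1 _ (by rw [c0, c2, c3, c5]; exact hD2) (by rw [c0, c2, c3, c4, c5]; exact hD12)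
      (by rw [c0, c3, c4, c5]; exact h3) (by rw [c0, c2, c3, c5]; exact hc0) (by rw [c0, c1, c2, c3, c4, c5]; exact hlam)
      (by rw [c0, c1, c2, c3, c4, c5]; exact hH)

/-- **THEOREM (THE MARK AGAINST TWO DEFORMED LEAVES AND `q ≥ 11` TYPE-2 MARKS)**: `θ_△(v 1, v x * v y * v 0 ^ q) ∈ cone` for
every `q ≥ 11` and all `x, y ∈ [0, 1]`, by the certificate L₂(1, 0) (numerically the certificate is valid from `q = 4` on;
`q ≥ 11` is what the crude bound `|D| ≤ 933/2` on the `P₂`-free part of the Hankel form needs). -/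
theorem InCone_thetaTri_v1_v_v_pow_zero (q : ℕ) (hq : 11 ≤ q) (x y : ℝ) (hx : 0 ≤ x ∧ x ≤ 1) (hy : 0 ≤ y ∧ y ≤ 1) :
    InCone (thetaTri (v 1) (v x * v y * v 0 ^ q)) := by
  obtain ⟨c0, c1, c2, c3, c4, c5⟩ := v_mul_v_mul_pow_zero_coords q (by omega) x y
  have hQ : (2048 : ℝ) ≤ 2 ^ q := by
    calc (2048 : ℝ) = 2 ^ 11 := by norm_num
      _ ≤ 2 ^ q := pow_le_pow_right₀ (by norm_num) hq
  have hx0 := hx.1; have hx1 := hx.2; have hy0 := hy.1; have hy1 := hy.2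
  have hx2 : x ^ 2 ≤ 1 := by nlinarith
  have hy2 : y ^ 2 ≤ 1 := by nlinarith
  -- the invariants: r = (1+x²)(1+y²) ∈ [1, 4], B = (1−x)(1−y) ∈ [0, 1], qq = (1+(1−x)²)(1+(1−y)²) ≥ 1
  have hr : (1 : ℝ) ≤ (1 + x ^ 2) * (1 + y ^ 2) := by nlinarith [sq_nonneg x, sq_nonneg y, mul_nonneg (sq_nonneg x) (sq_nonneg y)]
  have hr4 : (1 + x ^ 2) * (1 + y ^ 2) ≤ 4 := by nlinarith [mul_le_mul hx2 hy2 (sq_nonneg y) zero_le_one]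
  have hB : (0 : ℝ) ≤ (1 - x) * (1 - y) := mul_nonneg (by linarith) (by linarith)
  have hB1 : (1 - x) * (1 - y) ≤ 1 := by nlinarith
  have hqq : (1 : ℝ) ≤ (1 + (1 - x) ^ 2) * (1 + (1 - y) ^ 2) := by
    nlinarith [sq_nonneg (1 - x), sq_nonneg (1 - y), mul_nonneg (sq_nonneg (1 - x)) (sq_nonneg (1 - y))]
  -- C := 18 r − 49/2 + 17/2 B ≥ 3/8 (a sum of squares plus a positive constant)
  have hC : (3 : ℝ) / 8 ≤ 18 * ((1 + x ^ 2) * (1 + y ^ 2)) - 49 / 2 + 17 / 2 * ((1 - x) * (1 - y)) := by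
    nlinarith [sq_nonneg (x - 17 / 89 + 17 / 72 * (y - 17 / 89)), sq_nonneg (y - 17 / 89), sq_nonneg (x * y)]
  generalize hr' : (1 + x ^ 2) * (1 + y ^ 2) = r at *
  generalize hB' : (1 - x) * (1 - y) = B at *
  generalize hqq' : (1 + (1 - x) ^ 2) * (1 + (1 - y) ^ 2) = qq at *
  generalize hQ' : (2 : ℝ) ^ q = Q at *
  have hZ : 2048 * qq ≤ Q * qq := by nlinarith
  have hZ1 : (2048 : ℝ) ≤ Q * qq := by nlinarith
  apply InCone_thetaTri_v1_of_L2 (v x * v y * v 0 ^ q) 1 0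
  · norm_num
  · rw [c0, c3, c4, c5]; linarith
  · rw [c0, c1, c3, c4, c5]; linarith
  · norm_num
  · rw [c0, c1, c3, c4, c5]; linarith
  · rw [c0, c2, c3, c4, c5]; linarith
  · rw [c0, c1, c2, c3, c4, c5]; linarith
  · rw [c0, c1, c2, c3, c4, c5]
    -- Hankel = Z·C + D with Z = Q qq, C ≥ 3/8, D ≥ −933/2
    have hD : -(933 / 2 : ℝ) ≤ (6 * r - 5 - B) * (3 / 2 * B - 7 / 2) - (8 - 6 * r - 4 * B) ^ 2 := by
      have h1 : 0 ≤ 6 * r - 5 - B := by linarith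
      have h2 : 6 * r - 5 - B ≤ 19 := by linarith
      have h3 : -(7 / 2 : ℝ) ≤ 3 / 2 * B - 7 / 2 := by linarith
      have h4 : 3 / 2 * B - 7 / 2 ≤ 0 := by linarith
      have h5 : (8 - 6 * r - 4 * B) ^ 2 ≤ 400 := by
        have h6 : -20 ≤ 8 - 6 * r - 4 * B := by linarith
        have h7 : 8 - 6 * r - 4 * B ≤ 2 := by linarith
        nlinarith only [h6, h7]
      have h8 := mul_le_mul_of_nonneg_left h3 h1
      linarith
    have key : (2 * (Q * qq) + 4 * 1 - 0 / 2 - 5 / 2 * B - 6 * r + 1 / 2 - (Q * qq - 3 * 1 - 0 / 2 + 4 * 0 + 3 / 2 * B - 1 / 2)) ^ 2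
        ≤ (6 * r + Q * qq - 5 * 1 + 3 * 0 - 4 * 0 - B - 0) * (Q * qq - 3 * 1 - 0 / 2 + 4 * 0 + 3 / 2 * B - 1 / 2) := by
      have e : (6 * r + Q * qq - 5 * 1 + 3 * 0 - 4 * 0 - B - 0) * (Q * qq - 3 * 1 - 0 / 2 + 4 * 0 + 3 / 2 * B - 1 / 2)
          - (2 * (Q * qq) + 4 * 1 - 0 / 2 - 5 / 2 * B - 6 * r + 1 / 2 - (Q * qq - 3 * 1 - 0 / 2 + 4 * 0 + 3 / 2 * B - 1 / 2)) ^ 2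
          = (Q * qq) * (18 * r - 49 / 2 + 17 / 2 * B) + ((6 * r - 5 - B) * (3 / 2 * B - 7 / 2) - (8 - 6 * r - 4 * B) ^ 2) := by ring
      have hZC : 2048 * (3 / 8 : ℝ) ≤ (Q * qq) * (18 * r - 49 / 2 + 17 / 2 * B) :=
        mul_le_mul hZ1 hC (by norm_num) (by linarith)
      linarith [e, hZC, hD]
    exact key

end RelaxedTriangle

end PercRepro
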